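import Summits.KontsevichZagierPeriods.KontsevichZagierPeriods.Theses.FurushoPentagon
import Summits.KontsevichZagierPeriods.KontsevichZagierPeriods.Theses.LiftingCriteria
import Summits.KontsevichZagierPeriods.KontsevichZagierPeriods.Theorems.FurushoPentagonSectorToKernelCubeResolutionOfNash
import Summits.KontsevichZagierPeriods.KontsevichZagierPeriods.Theorems.FurushoPentagonSectorToKernelOfLeaves

/-!
# `SectorToKernel`, line `effective-cube-surjection`: the crux from item 3574 and Ayoub's conjecture

Crux `FurushoPentagon.SectorToKernel` (stmt-KontsevichZagierPeriods-10813). Corollaries of the two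
landed files of the continuation lead — `…CubeResolutionOfNash.lean` (the resolution stub S1 follows
verbatim from the EXISTING item stmt-KontsevichZagierPeriods-3574 `LiftingCriteria.CubeNashNormalForm`,
and from the resolution of bounded volume classes) and `…SectorToKernelOfLeaves.lean` (the line's
composition `S1 → S6 → SectorToKernel`, S6 = Ayoub, Ann. of Math. 181 (2015), Conj. 1.1 at `k = ℚ`):

* `sectorToKernel_of_cubeNashNormalForm_of_ayoubKernel` (registered):
  `LiftingCriteria.CubeNashNormalForm → S6 → SectorToKernel` — the crux reduced to ONE existing
  statement item of the tree plus ONE printed open conjecture, by name;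
* `kontsevichZagierPeriods_of_cubeNashNormalForm_of_ayoubKernel`:
  `LiftingCriteria.CubeNashNormalForm → S6 → KontsevichZagierPeriods` — a second deciding shape for
  route LiftingCriteria's normal-form item: together with Ayoub's effective cube conjecture it already
  gives Conjecture 1 (cross-route bridge FurushoPentagon ↔ LiftingCriteria ↔ Ayoub 2015);
* `sectorToKernel_of_boundedVolumes_of_ayoubKernel`: the same with S1 replaced by its sharper
  residue, the cubical resolution of bounded `ℚ`-semialgebraic volume classes (Viu-Sos reduction).

S6 is written out as a hypothesis (no conjecture is asserted). [Ayoub 2015, Conj. 1.1; Ayoub 2014,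
Rem. 12–13; Kontsevich–Zagier 2001, §1.2; Viu-Sos 2021, Thm. 1.1]
-/

noncomputable section

namespace Summit.KontsevichZagierPeriods.FurushoPentagon.SectorToKernel

open Set MeasureTheory
open Literature.NumberTheory.Transcendental
open Literature.NumberTheory.Transcendental.KZ hiding cubicalSpan
open Summit.KontsevichZagierPeriods.KontsevichZagierPeriods.Theses.FurushoPentagon
open Summit.KontsevichZagierPeriods.FurushoPentagon.ReducedPeriodRing (cubicalSpan)

/-- **The crux from item stmt-KontsevichZagierPeriods-3574 and Ayoub's effective cube conjecture**
(registered stub of line `effective-cube-surjection`): `CubeNashNormalForm → (Ayoub 2015 Conj. 1.1 at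
k = ℚ) → SectorToKernel`. [Ayoub 2015, Conj. 1.1; Ayoub 2014, Rem. 12–13] -/
theorem sectorToKernel_of_cubeNashNormalForm_of_ayoubKernel :
    Summit.KontsevichZagierPeriods.KontsevichZagierPeriods.Theses.LiftingCriteria.CubeNashNormalForm → (∀ F ∈ AyoubRel.Oan (Rat.castHom ℂ), AyoubRel.intC F = 0 → F ∈ AyoubRel.kSpan (Rat.castHom ℂ) {x : AyoubRel.CSeries | ∃ G ∈ AyoubRel.Oan (Rat.castHom ℂ), ∃ i : ℕ, x = AyoubRel.relAC i G}) → SectorToKernel :=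
  fun hN h6 => sectorToKernel_of_cubeResolution_of_ayoubKernel (cubeResolution_of_cubeNashNormalForm hN) h6

/-- **Conjecture 1 from item stmt-KontsevichZagierPeriods-3574 and Ayoub's effective cube conjecture**:
the cube-Nash normal form of route LiftingCriteria together with Ayoub 2015 Conj. 1.1 at `k = ℚ`
implies `KontsevichZagierPeriods`. [Ayoub 2015, §1.1; Kontsevich–Zagier 2001, §1.2] -/
theorem kontsevichZagierPeriods_of_cubeNashNormalForm_of_ayoubKernel
    (hN : Summit.KontsevichZagierPeriods.KontsevichZagierPeriods.Theses.LiftingCriteria.CubeNashNormalForm)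
    (h6 : ∀ F ∈ AyoubRel.Oan (Rat.castHom ℂ), AyoubRel.intC F = 0 →
      F ∈ AyoubRel.kSpan (Rat.castHom ℂ)
        {x : AyoubRel.CSeries | ∃ G ∈ AyoubRel.Oan (Rat.castHom ℂ), ∃ i : ℕ, x = AyoubRel.relAC i G}) :
    KontsevichZagierPeriods :=
  kontsevichZagierPeriods_of_cubeResolution_of_ayoubKernel (cubeResolution_of_cubeNashNormalForm hN) h6

/-- **The crux from the resolution of bounded volumes and Ayoub's effective cube conjecture**: if
every bounded `ℚ`-semialgebraic volume class `[K, 1]` is, modulo the KZ relations, a `ℤ`-combination of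
tame cube classes, then Ayoub 2015 Conj. 1.1 at `k = ℚ` implies `SectorToKernel`.
[Viu-Sos 2021, Thm. 1.1; Ayoub 2015, Conj. 1.1] -/
theorem sectorToKernel_of_boundedVolumes_of_ayoubKernel
    (hV : ∀ (m : ℕ) (K : IntegralRep m), Bornology.IsBounded K.domain →
      (∀ x ∈ K.domain, K.integrand x = 1) → ∃ c : FormalRep, c ∈ cubicalSpan ∧ of K - c ∈ relations)
    (h6 : ∀ F ∈ AyoubRel.Oan (Rat.castHom ℂ), AyoubRel.intC F = 0 →
      F ∈ AyoubRel.kSpan (Rat.castHom ℂ)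
        {x : AyoubRel.CSeries | ∃ G ∈ AyoubRel.Oan (Rat.castHom ℂ), ∃ i : ℕ, x = AyoubRel.relAC i G}) :
    SectorToKernel :=
  sectorToKernel_of_cubeResolution_of_ayoubKernel (cubeResolution_of_boundedVolumes hV) h6

end Summit.KontsevichZagierPeriods.FurushoPentagon.SectorToKernel
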